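import Mathlib.Analysis.SpecialFunctions.Integrability.Basic
import Literature.NumberTheory.LFunctions.NicolasMellin
import Literature.NumberTheory.Sieve.SieveAdjointP
import HarnessLib

/-!
# Euler's integral for `γ`, `Ein = γ + log + E_1`, and `p_1(1) = e^{−γ}`

Trunk `AntSieve` (topic `NumberTheory/Sieve`; analytic lemmas for the linear sieve constant).
The constant of the linear sieve is `A_1 = 2/p_1(1)` with `p_1(s) = ∫_0^∞ exp(−s x − Ein(x)) dx`
(`rosserAdjointP 1`, file `SieveAdjointP`; [Greaves2001, Lemma 4.2.5 (4.11)]). The classical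
evaluation `p_1(1) = e^{−γ}` [Greaves2001, Lemma 4.2.4 (ii), used in the proof of Lemma 4.2.5:
"`C = 2e^γ` because of part (ii) of Lemma 4"] rests on Euler's integral
`e^γ = exp(∫_0^1 (1 − e^{−t})/t dt − ∫_1^∞ e^{−t}/t dt)` [Greaves2001, p. 98, the `κ < 1/2`
case of the proof of Lemma 4.2.5], i.e. `Ein(x) = γ + log x + E_1(x)`
(`E_1(x) = ∫_x^∞ e^{−t}/t dt`), and the
substitution `u = E_1(x)`:
`∫_0^∞ e^{−x − Ein x} dx = e^{−γ} ∫_0^∞ (e^{−x}/x) e^{−E_1(x)} dx = e^{−γ}`.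
This file PROVES these identities, deriving Euler's integral from
`∫_0^∞ log t · e^{−t} dt = Γ'(1) = −γ` (`Literature.NumberTheory.LFunctions.Nicolas.integral_log_mul_exp_neg`, file
`Literature/NumberTheory/LFunctions/NicolasMellin`, whence the import; a librarian refactor may
move that lemma to a neutral special-functions file) by two integrations by parts.

## Main results

* `eulerMascheroniConstant_eq_ein_one_sub` : `γ = Ein(1) − ∫_1^∞ e^{−t}/t dt`.
* `expIntegralE1`, `ein_eq_add` : `Ein(x) = γ + log x + E_1(x)` for `x > 0`.
* `rosserAdjointP_one_one` : `p_1(1) = e^{−γ}`.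

## References

* [Greaves2001] G. Greaves, *Sieves in Number Theory*, Springer (2001), §4.2.3 Lemma 4.2.4,
  §4.2.4 Lemma 4.2.5 and its proof.
-/

open Filter Asymptotics Set Topology MeasureTheory

noncomputable section

namespace Literature.NumberTheory.Sieve

/-! ### Integrability lemmas -/

/-- `e^{−t} log t` is integrable on `(1, ∞)`. [folklore] -/
theorem integrableOn_exp_neg_mul_log_Ioi_one :
    IntegrableOn (fun t : ℝ => Real.exp (-t) * Real.log t) (Ioi 1) := by
  refine integrable_of_isBigO_exp_neg (b := 1 / 2) (by norm_num) ?_ ?_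
  · exact (Real.continuous_exp.comp continuous_neg).continuousOn.mul
      (Real.continuousOn_log.mono fun t (ht : 1 ≤ t) => ne_of_gt (show (0 : ℝ) < t by linarith))
  · have h1 : (fun t : ℝ => Real.exp (-t) * Real.log t) =O[atTop] fun t => Real.exp (-t) * t := by
      refine IsBigO.of_bound 1 ?_
      filter_upwards [eventually_ge_atTop (1 : ℝ)] with t ht
      rw [norm_mul, norm_mul, one_mul, Real.norm_of_nonneg (Real.log_nonneg ht),
        Real.norm_of_nonneg (by linarith : (0 : ℝ) ≤ t)]
      exact mul_le_mul_of_nonneg_left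
        ((Real.log_le_sub_one_of_pos (by linarith)).trans (by linarith)) (norm_nonneg _)
    have h2 : (fun t : ℝ => Real.exp (-t) * t) =o[atTop]
        fun t => Real.exp (-t) * Real.exp (1 / 2 * t) :=
      (isBigO_refl _ _).mul_isLittleO
        (by simpa using isLittleO_pow_exp_pos_mul_atTop 1 (by norm_num : (0 : ℝ) < 1 / 2))
    refine (h1.trans h2.isBigO).trans (IsBigO.of_bound 1 (Eventually.of_forall fun t => ?_))
    rw [← Real.exp_add, one_mul, Real.norm_eq_abs, Real.norm_eq_abs, Real.abs_exp, Real.abs_exp,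
      Real.exp_le_exp]
    linarith

/-- `e^{−t} log t` is interval integrable on `[0, 1]` (logarithmic singularity). [folklore] -/
theorem intervalIntegrable_exp_neg_mul_log :
    IntervalIntegrable (fun t : ℝ => Real.exp (-t) * Real.log t) volume 0 1 :=
  (intervalIntegral.intervalIntegrable_log').continuousOn_mul
    (Continuous.continuousOn (by fun_prop))

/-- `e^{−t}/t` is integrable on `(x, ∞)` for `x > 0`. [folklore] -/
theorem integrableOn_exp_neg_div_Ioi {x : ℝ} (hx : 0 < x) :
    IntegrableOn (fun t : ℝ => Real.exp (-t) / t) (Ioi x) := by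
  refine integrable_of_isBigO_exp_neg (b := 1) one_pos ?_ ?_
  · exact (Real.continuous_exp.comp continuous_neg).continuousOn.div continuousOn_id
      fun t (ht : x ≤ t) => ne_of_gt (hx.trans_le ht)
  · refine IsBigO.of_bound x⁻¹ ?_
    filter_upwards [eventually_ge_atTop x] with t ht
    have ht0 : 0 < t := hx.trans_le ht
    rw [Real.norm_of_nonneg (div_nonneg (Real.exp_pos _).le ht0.le), neg_mul, one_mul,
      Real.norm_of_nonneg (Real.exp_pos _).le, div_eq_mul_inv, mul_comm]
    exact mul_le_mul_of_nonneg_right ((inv_le_inv₀ ht0 hx).mpr ht) (Real.exp_pos _).le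

/-! ### Euler's integral for `γ` -/

/-- First integration by parts: `Ein(1) = ∫_0^1 (1 − e^{−t})/t dt = −∫_0^1 e^{−t} log t dt`
(`((1 − e^{−t}) log t)' = e^{−t} log t + (1 − e^{−t})/t`, and `(1 − e^{−t}) log t → 0` at `0⁺`).
[folklore] -/
theorem ein_one_eq_neg_integral : ein 1 = -∫ t in (0 : ℝ)..1, Real.exp (-t) * Real.log t := by
  set G : ℝ → ℝ := fun t => (1 - Real.exp (-t)) * Real.log t with hG
  -- derivative on `(0, 1)`
  have hGd : ∀ t ∈ Ioo (0 : ℝ) 1,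
      HasDerivAt G (Real.exp (-t) * Real.log t + (1 - Real.exp (-t)) * t⁻¹) t := by
    intro t ht
    have h1 : HasDerivAt (fun t : ℝ => 1 - Real.exp (-t)) (Real.exp (-t)) t := by
      have := ((hasDerivAt_id t).neg.exp).const_sub 1
      simpa using this
    exact (h1.mul (Real.hasDerivAt_log ht.1.ne')).congr_deriv (by ring)
  -- continuity on `[0, 1]`
  have hGc : ContinuousOn G (Icc 0 1) := by
    intro t ht
    rcases ht.1.eq_or_lt with h0 | h0
    · -- at `t = 0`
      subst h0
      have hG0 : G 0 = 0 := by simp [hG]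
      have hlim : Tendsto G (𝓝[Icc 0 1] 0) (𝓝 0) := by
        have hb : Tendsto (fun t : ℝ => t * Real.log t) (𝓝[Icc 0 1] 0) (𝓝 0) := by
          have := (Real.continuous_mul_log.tendsto 0)
          simp only [zero_mul] at this
          exact this.mono_left nhdsWithin_le_nhds
        refine squeeze_zero_norm' ?_ (tendsto_norm_zero.comp hb)
        filter_upwards [self_mem_nhdsWithin] with t ht
        show ‖(1 - Real.exp (-t)) * Real.log t‖ ≤ ‖t * Real.log t‖
        rw [norm_mul, norm_mul]
        refine mul_le_mul_of_nonneg_right ?_ (norm_nonneg _)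
        have h1 : 0 ≤ 1 - Real.exp (-t) := by
          linarith [Real.exp_le_one_iff.mpr (by linarith [ht.1] : -t ≤ 0)]
        rw [Real.norm_of_nonneg h1, Real.norm_of_nonneg ht.1]
        linarith [Real.add_one_le_exp (-t)]
      rw [ContinuousWithinAt, hG0]
      exact hlim
    · exact ((continuousAt_const.sub (Real.continuous_exp.comp continuous_neg).continuousAt).mul
        (Real.continuousAt_log h0.ne')).continuousWithinAt
  -- integrability of the derivative
  have hK : IntervalIntegrable (fun t : ℝ => (1 - Real.exp (-t)) * t⁻¹) volume 0 1 := by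
    refine (continuous_einKernel.intervalIntegrable 0 1).congr fun t ht => ?_
    rw [uIoc_of_le zero_le_one] at ht
    rw [einKernel_eq_div ht.1.ne', div_eq_mul_inv]
  have hint : IntervalIntegrable (fun t => Real.exp (-t) * Real.log t + (1 - Real.exp (-t)) * t⁻¹)
      volume 0 1 := intervalIntegrable_exp_neg_mul_log.add hK
  have hFTC := intervalIntegral.integral_eq_sub_of_hasDerivAt_of_le zero_le_one hGc hGd hint
  have hG1 : G 1 = 0 := by simp [hG]
  have hG0 : G 0 = 0 := by simp [hG]
  rw [hG1, hG0, sub_zero, intervalIntegral.integral_add intervalIntegrable_exp_neg_mul_log hK]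
    at hFTC
  -- `∫_0^1 (1 - e^{-t}) t⁻¹ = ein 1`
  have hE : ∫ t in (0 : ℝ)..1, (1 - Real.exp (-t)) * t⁻¹ = ein 1 := by
    rw [ein]
    refine intervalIntegral.integral_congr_ae (Eventually.of_forall fun t ht => ?_)
    rw [uIoc_of_le zero_le_one] at ht
    rw [einKernel_eq_div ht.1.ne', div_eq_mul_inv]
  linarith

/-- Second integration by parts: `∫_1^∞ e^{−t}/t dt = ∫_1^∞ e^{−t} log t dt`
(`(e^{−t} log t)' = −e^{−t} log t + e^{−t}/t`, `e^{−t} log t → 0`). [folklore] -/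
theorem integral_exp_neg_div_Ioi_one :
    ∫ t in Ioi (1 : ℝ), Real.exp (-t) / t = ∫ t in Ioi (1 : ℝ), Real.exp (-t) * Real.log t := by
  set G : ℝ → ℝ := fun t => Real.exp (-t) * Real.log t with hG
  have hGd : ∀ t ∈ Ici (1 : ℝ),
      HasDerivAt G (-(Real.exp (-t) * Real.log t) + Real.exp (-t) / t) t := by
    intro t ht
    have ht0 : (0 : ℝ) < t := by simp only [mem_Ici] at ht; linarith
    have h1 : HasDerivAt (fun t : ℝ => Real.exp (-t)) (-Real.exp (-t)) t := by
      simpa using (hasDerivAt_id t).neg.exp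
    exact (h1.mul (Real.hasDerivAt_log ht0.ne')).congr_deriv (by rw [div_eq_mul_inv]; ring)
  have hint : IntegrableOn (fun t => -(Real.exp (-t) * Real.log t) + Real.exp (-t) / t) (Ioi 1) :=
    integrableOn_exp_neg_mul_log_Ioi_one.neg.add (integrableOn_exp_neg_div_Ioi one_pos)
  have hlim : Tendsto G atTop (𝓝 0) := by
    have h1 : G =O[atTop] fun t => Real.exp (-t) * t := by
      refine IsBigO.of_bound 1 ?_
      filter_upwards [eventually_ge_atTop (1 : ℝ)] with t ht
      rw [hG, norm_mul, norm_mul, one_mul, Real.norm_of_nonneg (Real.log_nonneg ht),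
        Real.norm_of_nonneg (by linarith : (0 : ℝ) ≤ t)]
      exact mul_le_mul_of_nonneg_left
        ((Real.log_le_sub_one_of_pos (by linarith)).trans (by linarith)) (norm_nonneg _)
    refine h1.trans_tendsto ?_
    refine (tendsto_mul_exp_neg_mul (s := (1 : ℝ)) one_pos).congr fun x => ?_
    rw [one_mul, mul_comm]
  have hFTC := integral_Ioi_of_hasDerivAt_of_tendsto' hGd hint hlim
  have hG1 : G 1 = 0 := by simp [hG]
  have hI1 : Integrable (fun t => -(Real.exp (-t) * Real.log t)) (volume.restrict (Ioi 1)) :=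
    integrableOn_exp_neg_mul_log_Ioi_one.neg
  rw [hG1, sub_zero, integral_add hI1 (integrableOn_exp_neg_div_Ioi one_pos),
    MeasureTheory.integral_neg] at hFTC
  linarith

/-- **Euler's integral for `γ`**:
`γ = ∫_0^1 (1 − e^{−t})/t dt − ∫_1^∞ e^{−t}/t dt = Ein(1) − E_1(1)` [Greaves2001, p. 98, the
`κ < 1/2` case of the proof of Lemma 4.2.5:
"`e^γ = exp(∫_0^1 (1 − e^{−t})/t dt − ∫_1^∞ e^{−t}/t dt)`"].
[cite: Greaves2001, §4.2.4, proof of Lemma 4.2.5 (p. 98)] -/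
theorem eulerMascheroniConstant_eq_ein_one_sub :
    Real.eulerMascheroniConstant = ein 1 - ∫ t in Ioi (1 : ℝ), Real.exp (-t) / t := by
  -- `∫_0^∞ e^{-t} log t = -γ` (`Literature.NumberTheory.LFunctions.Nicolas.integral_log_mul_exp_neg`, up to `mul_comm`)
  have hcomm : EqOn (fun t : ℝ => Real.log t * Real.exp (-t)) (fun t => Real.exp (-t) * Real.log t)
      (Ioi 0) := fun t _ => mul_comm _ _
  have hint : IntegrableOn (fun t : ℝ => Real.exp (-t) * Real.log t) (Ioi 0) :=
    Literature.NumberTheory.LFunctions.Nicolas.integrableOn_log_mul_exp_neg.congr_fun hcomm measurableSet_Ioi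
  have hγ : ∫ t in Ioi (0 : ℝ), Real.exp (-t) * Real.log t = -Real.eulerMascheroniConstant := by
    rw [← setIntegral_congr_fun measurableSet_Ioi hcomm]
    exact Literature.NumberTheory.LFunctions.Nicolas.integral_log_mul_exp_neg
  have hsplit := intervalIntegral.integral_interval_add_Ioi hint
    integrableOn_exp_neg_mul_log_Ioi_one
  -- `∫_0^1 + ∫_{Ioi 1} = ∫_{Ioi 0} = -γ`
  rw [hγ] at hsplit
  rw [ein_one_eq_neg_integral, integral_exp_neg_div_Ioi_one]
  linarith

/-! ### The exponential integral `E_1` and `Ein = γ + log + E_1` -/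

/-- `E_1(x) = ∫_x^∞ e^{−t}/t dt`, the exponential integral (meaningful for `x > 0`). [folklore] -/
def expIntegralE1 (x : ℝ) : ℝ :=
  ∫ t in Ioi x, Real.exp (-t) / t

/-- `E_1(x) = E_1(1) − ∫_1^x e^{−t}/t dt` for `x > 0`. [folklore] -/
theorem expIntegralE1_eq {x : ℝ} (hx : 0 < x) :
    expIntegralE1 x = expIntegralE1 1 - ∫ t in (1 : ℝ)..x, Real.exp (-t) / t := by
  have := intervalIntegral.integral_Ioi_sub_Ioi' (integrableOn_exp_neg_div_Ioi one_pos)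
    (integrableOn_exp_neg_div_Ioi hx)
  rw [expIntegralE1, expIntegralE1]
  linarith

/-- `E_1'(x) = −e^{−x}/x` for `x > 0`. [folklore] -/
theorem hasDerivAt_expIntegralE1 {x : ℝ} (hx : 0 < x) :
    HasDerivAt expIntegralE1 (-(Real.exp (-x) / x)) x := by
  have hc : ContinuousOn (fun t : ℝ => Real.exp (-t) / t) (Ioi 0) :=
    (Real.continuous_exp.comp continuous_neg).continuousOn.div continuousOn_id
      fun t (ht : 0 < t) => ne_of_gt ht
  have hP : HasDerivAt (fun u => ∫ t in (1 : ℝ)..u, Real.exp (-t) / t) (Real.exp (-x) / x) x := by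
    refine intervalIntegral.integral_hasDerivAt_right ?_
      (hc.stronglyMeasurableAtFilter isOpen_Ioi x hx) (hc.continuousAt (Ioi_mem_nhds hx))
    refine (hc.mono fun t ht => ?_).intervalIntegrable
    exact lt_of_lt_of_le (lt_min one_pos hx) ht.1
  refine (hP.const_sub (expIntegralE1 1)).congr_of_eventuallyEq ?_
  filter_upwards [Ioi_mem_nhds hx] with y (hy : 0 < y)
  exact expIntegralE1_eq hy

/-- **`Ein(x) = γ + log x + E_1(x)`** for `x > 0` (the derivative of `Ein − log − E_1` vanishes on
`(0, ∞)`, and at `x = 1` the identity is Euler's integral).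
[cite: Greaves2001, §4.2.4, proof of Lemma 4.2.5] -/
theorem ein_eq_add {x : ℝ} (hx : 0 < x) :
    ein x = Real.eulerMascheroniConstant + Real.log x + expIntegralE1 x := by
  set D : ℝ → ℝ := fun y => ein y - Real.log y - expIntegralE1 y with hD
  have hDd : ∀ y : ℝ, 0 < y → HasDerivAt D 0 y := by
    intro y hy
    have h := ((hasDerivAt_ein y).sub (Real.hasDerivAt_log hy.ne')).sub
      (hasDerivAt_expIntegralE1 hy)
    refine h.congr_deriv ?_
    rw [einKernel_eq_div hy.ne']
    field_simp
    ring
  have hconst : D x = D 1 :=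
    isOpen_Ioi.is_const_of_deriv_eq_zero isPreconnected_Ioi
      (fun y (hy : 0 < y) => (hDd y hy).differentiableAt.differentiableWithinAt)
      (fun y (hy : 0 < y) => (hDd y hy).deriv) (show x ∈ Ioi 0 from hx)
      (show (1 : ℝ) ∈ Ioi 0 from show (0 : ℝ) < 1 from one_pos)
  have hD1 : D 1 = Real.eulerMascheroniConstant := by
    simp only [hD, Real.log_one, sub_zero]
    rw [eulerMascheroniConstant_eq_ein_one_sub, expIntegralE1]
  have : D x = ein x - Real.log x - expIntegralE1 x := rfl
  linarith [hconst, hD1, this]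

/-- `E_1(x) → 0` as `x → ∞` (`0 ≤ E_1(x) ≤ e^{−x}` for `x ≥ 1`). [folklore] -/
theorem tendsto_expIntegralE1_atTop : Tendsto expIntegralE1 atTop (𝓝 0) := by
  have hup : ∀ x : ℝ, 1 ≤ x → expIntegralE1 x ≤ Real.exp (-x) := by
    intro x hx
    rw [expIntegralE1, ← integral_exp_neg_Ioi x]
    refine setIntegral_mono_on (integrableOn_exp_neg_div_Ioi (by linarith))
      (by simpa using exp_neg_integrableOn_Ioi x one_pos) measurableSet_Ioi fun t (ht : x < t) => ?_
    rw [div_le_iff₀ (by linarith)]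
    nlinarith [Real.exp_pos (-t)]
  have hlo : ∀ x : ℝ, 0 < x → 0 ≤ expIntegralE1 x := fun x hx =>
    setIntegral_nonneg measurableSet_Ioi fun t (ht : x < t) =>
      div_nonneg (Real.exp_pos _).le (hx.trans ht).le
  have h0 : Tendsto (fun x : ℝ => Real.exp (-x)) atTop (𝓝 0) :=
    Real.tendsto_exp_atBot.comp tendsto_neg_atTop_atBot
  refine squeeze_zero' ?_ ?_ h0
  · filter_upwards [eventually_gt_atTop (0 : ℝ)] with x hx using hlo x hx
  · filter_upwards [eventually_ge_atTop (1 : ℝ)] with x hx using hup x hx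

/-- `E_1(x) → +∞` as `x → 0⁺` (`E_1 = Ein − γ − log`). [folklore] -/
theorem tendsto_expIntegralE1_nhdsGT_zero : Tendsto expIntegralE1 (𝓝[>] 0) atTop := by
  have h1 : Tendsto (fun x : ℝ => ein x - Real.eulerMascheroniConstant) (𝓝[>] 0)
      (𝓝 (ein 0 - Real.eulerMascheroniConstant)) :=
    ((continuous_ein.tendsto 0).sub tendsto_const_nhds).mono_left nhdsWithin_le_nhds
  have h2 : Tendsto (fun x : ℝ => -Real.log x) (𝓝[>] 0) atTop :=
    tendsto_neg_atBot_atTop.comp Real.tendsto_log_nhdsGT_zero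
  refine (h1.add_atTop h2).congr' ?_
  filter_upwards [self_mem_nhdsWithin] with x (hx : 0 < x)
  rw [ein_eq_add hx]
  ring

/-! ### `p_1(1) = e^{−γ}` -/

/-- **`p_1(1) = ∫_0^∞ exp(−x − Ein x) dx = e^{−γ}`** [Greaves2001, Lemma 4.2.4 (ii) for `κ = 1`,
as used in the proof of Lemma 4.2.5]: with `Ein = γ + log + E_1` the integrand is
`e^{−γ} (e^{−x}/x) e^{−E_1(x)} = e^{−γ} (e^{−E_1})'(x)`, and `e^{−E_1}` increases from `0` to `1`.
[cite: Greaves2001, Lemma 4.2.4 and proof of Lemma 4.2.5] -/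
theorem rosserAdjointP_one_one : rosserAdjointP 1 1 = Real.exp (-Real.eulerMascheroniConstant) := by
  set γ : ℝ := Real.eulerMascheroniConstant with hγ
  -- `H = exp (-E_1)` extended by `0` at `0`
  set H : ℝ → ℝ := fun x => if 0 < x then Real.exp (-expIntegralE1 x) else 0 with hH
  have hHeq : ∀ x : ℝ, 0 < x → H x = Real.exp (-expIntegralE1 x) := fun x hx => by simp [hH, hx]
  have hHev : ∀ x : ℝ, 0 < x → H =ᶠ[𝓝 x] fun y => Real.exp (-expIntegralE1 y) := fun x hx => by
    filter_upwards [Ioi_mem_nhds hx] with y hy using hHeq y hy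
  -- derivative on `(0, ∞)`
  have hHd : ∀ x ∈ Ioi (0 : ℝ),
      HasDerivAt H (Real.exp (-expIntegralE1 x) * (Real.exp (-x) / x)) x := by
    intro x (hx : 0 < x)
    refine (((hasDerivAt_expIntegralE1 hx).neg.exp).congr_of_eventuallyEq
      (hHev x hx)).congr_deriv ?_
    simp only [Pi.neg_apply, neg_neg, div_eq_mul_inv]
  -- right-continuity at `0`
  have hH0 : ContinuousWithinAt H (Ici 0) 0 := by
    rw [← continuousWithinAt_Ioi_iff_Ici, ContinuousWithinAt]
    have hH00 : H 0 = 0 := by simp [hH]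
    rw [hH00]
    have h1 : Tendsto (fun x => Real.exp (-expIntegralE1 x)) (𝓝[>] 0) (𝓝 0) :=
      Real.tendsto_exp_atBot.comp (tendsto_neg_atTop_atBot.comp tendsto_expIntegralE1_nhdsGT_zero)
    refine h1.congr' ?_
    filter_upwards [self_mem_nhdsWithin] with x hx using (hHeq x hx).symm
  -- limit at infinity
  have hHlim : Tendsto H atTop (𝓝 1) := by
    have h1 : Tendsto (fun x => Real.exp (-expIntegralE1 x)) atTop (𝓝 1) := by
      have h0 : Tendsto (fun x => -expIntegralE1 x) atTop (𝓝 0) := by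
        simpa using tendsto_expIntegralE1_atTop.neg
      have := (Real.continuous_exp.tendsto 0).comp h0
      rw [Real.exp_zero] at this
      exact this
    refine h1.congr' ?_
    filter_upwards [eventually_gt_atTop (0 : ℝ)] with x hx using (hHeq x hx).symm
  -- the derivative is `e^{γ}` times the integrand of `p_1(1)`
  have hint0 := rosserAdjointP.integrableOn_integrand (κ := 1) (s := 1) zero_le_one one_pos
  have hEqOn : EqOn (fun x => Real.exp (-expIntegralE1 x) * (Real.exp (-x) / x))
      (fun x => Real.exp γ * Real.exp (-(1 * x) - 1 * ein x)) (Ioi 0) := by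
    intro x (hx : 0 < x)
    simp only [one_mul]
    rw [ein_eq_add hx]
    have h1 : Real.exp γ *
          Real.exp (-x - (Real.eulerMascheroniConstant + Real.log x + expIntegralE1 x)) =
        Real.exp (-expIntegralE1 x) * Real.exp (-x) * Real.exp (-Real.log x) := by
      rw [← Real.exp_add, ← Real.exp_add, ← Real.exp_add, hγ]
      congr 1
      ring
    rw [h1, Real.exp_neg (Real.log x), Real.exp_log hx, div_eq_mul_inv, mul_assoc]
  have hint1 : IntegrableOn (fun x => Real.exp γ * Real.exp (-(1 * x) - 1 * ein x)) (Ioi 0) :=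
    hint0.const_mul (Real.exp γ)
  have hH'int : IntegrableOn (fun x => Real.exp (-expIntegralE1 x) * (Real.exp (-x) / x)) (Ioi 0) :=
    hint1.congr_fun hEqOn.symm measurableSet_Ioi
  have hFTC := integral_Ioi_of_hasDerivAt_of_tendsto hH0 hHd hH'int hHlim
  have hH00 : H 0 = 0 := by simp [hH]
  rw [hH00, sub_zero, setIntegral_congr_fun measurableSet_Ioi hEqOn,
    MeasureTheory.integral_const_mul] at hFTC
  -- conclude
  rw [rosserAdjointP_def]
  have hpos : 0 < Real.exp γ := Real.exp_pos _
  have : ∫ x in Ioi 0, Real.exp (-(1 * x) - 1 * ein x) = (Real.exp γ)⁻¹ := by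
    field_simp at hFTC ⊢
    linarith
  rw [this, Real.exp_neg]

end Literature.NumberTheory.Sieve
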